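import Mathlib
import Literature.NumberTheory.Automorphic.TwistedQuotientConeDescentRows
import HarnessLib

/-!
# Normalising a cut-off into a `Γ`-partition of unity — crux HeckeEigenvalueField
# (stmt-Langlands-13632), line Sketch, stub `stub_isPOU_of_cover`

Setting of `Literature.NumberTheory.Automorphic.TwistedQuotientConeDescentRows`: a group `Γ` acts
linearly (`a : Γ →* (W →L[ℝ] W)`) on a finite-dimensional real normed space `W`, and `X ⊆ W` is a
`Γ`-stable open set.

Statement.  If `χ ≥ 0` is smooth on `X`, the family of translates `χ_γ = χ ∘ a γ⁻¹` is locally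
finite on `X` and every point of `X` has a translate with `χ_γ = 1`, then, with
`F = ∑ᶠ_γ χ_γ`: `ψ = χ / F` is a `Γ`-partition of unity on `X` (`TwistedQuotient.IsPOU`);
`1 ≤ F` on `X`; `F ∘ a δ = F`; `0 ≤ ψ ∘ a δ⁻¹ ≤ 1` on `X`; and at `x ∈ X`, for every finite `s ⊆ Γ`
off which the translates vanish identically near `x`, the quotient-rule bounds
`‖D(ψ ∘ a δ⁻¹)(x)‖ ≤ ‖Dχ_δ(x)‖ + |χ_δ(x)| ∑_{γ ∈ s} ‖Dχ_γ(x)‖` and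
`‖D²(ψ ∘ a δ⁻¹)(x)‖ ≤ ‖D²χ_δ‖ + 2 ‖Dχ_δ‖ ∑_s ‖Dχ_γ‖ + |χ_δ| (∑_s ‖D²χ_γ‖ + 2 (∑_s ‖Dχ_γ‖)²)`
(all derivatives at `x`).

Proof.  Near a point of `X` only finitely many translates are non-zero, so `F` is locally a finite
sum of smooth functions (`finsum_eq_sum_of_support_subset`); `F ≥ 1` because the translate with
`χ_γ = 1` contributes `1` and the others are `≥ 0` (translates of points of `X` stay in `X`);
`F ∘ a δ = F` by reindexing `γ ↦ δ⁻¹ γ`.  Hence `ψ ∘ a δ⁻¹ = χ_δ / F` on `X`, and near `x` moreover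
`F = ∑_{γ ∈ s} χ_γ`; the bounds are the Leibniz rule for `χ_δ · F⁻¹` at `x`, with `|F⁻¹| ≤ 1`,
`D F⁻¹ = -F⁻² DF` (so `‖D F⁻¹‖ ≤ ‖DF‖`), `D² F⁻¹ = -F⁻² D²F + 2 F⁻³ DF ⊗ DF` (so
`‖D² F⁻¹‖ ≤ ‖D²F‖ + 2 ‖DF‖²`), `‖DF‖ ≤ ∑_s ‖Dχ_γ‖` and `‖D²F‖ ≤ ∑_s ‖D²χ_γ‖`.

## References

* R. Bott, L. W. Tu, *Differential Forms in Algebraic Topology*, GTM 82 (1982), §II.8 (partitions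
  of unity and the Čech–de Rham complex). [BottTu1982Forms]
-/

set_option linter.dupNamespace false -- project-wide: `Summit.Langlands.Langlands` is the mandated namespace

noncomputable section

open Filter Topology Set
open scoped ContDiff Topology
open Literature.NumberTheory.Automorphic

namespace Summit.Langlands.Langlands.Theorems.HeckeEigenvalueField.Res

namespace POUNormalise

variable {E : Type*} [NormedAddCommGroup E] [NormedSpace ℝ E]

/-- `‖D²f(x)‖ = ‖D(Df)(x)‖` (currying the second derivative is an isometry). [folklore] -/
theorem norm_iteratedFDeriv_two {F : Type*} [NormedAddCommGroup F] [NormedSpace ℝ F]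
    (f : E → F) (x : E) : ‖iteratedFDeriv ℝ 2 f x‖ = ‖fderiv ℝ (fderiv ℝ f) x‖ := by
  rw [← norm_iteratedFDeriv_fderiv, ← norm_iteratedFDeriv_fderiv, norm_iteratedFDeriv_zero]

/-- **The reciprocal of a `C²` function at a point where it is `≥ 1`.**  `|F⁻¹| ≤ 1`,
`‖D F⁻¹‖ ≤ ‖DF‖` and `‖D² F⁻¹‖ ≤ ‖D²F‖ + 2 ‖DF‖²` at the point (chain rule: `D F⁻¹ = -F⁻² DF`
near the point, differentiated once more by the product rule). [folklore] -/
theorem inv_bounds {Fs : E → ℝ} {x : E} (hFs : ContDiffAt ℝ 2 Fs x) (h1 : 1 ≤ Fs x) :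
    |(Fs x)⁻¹| ≤ 1 ∧
    ‖fderiv ℝ (fun y => (Fs y)⁻¹) x‖ ≤ ‖fderiv ℝ Fs x‖ ∧
    ‖fderiv ℝ (fderiv ℝ fun y => (Fs y)⁻¹) x‖ ≤
      ‖fderiv ℝ (fderiv ℝ Fs) x‖ + 2 * ‖fderiv ℝ Fs x‖ ^ 2 := by
  have hpos : 0 < Fs x := one_pos.trans_le h1
  have hne : Fs x ≠ 0 := hpos.ne'
  have h2 : (2 : WithTop ℕ∞) ≠ ∞ := by simp
  have hd : DifferentiableAt ℝ Fs x := hFs.differentiableAt (by simp)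
  -- the value
  have hg0 : |(Fs x)⁻¹| ≤ 1 := by
    rw [abs_of_pos (inv_pos.2 hpos)]
    exact inv_le_one_of_one_le₀ h1
  -- the gradient at `x`
  have hginv : HasFDerivAt (fun y => (Fs y)⁻¹) ((-(Fs x ^ 2)⁻¹) • fderiv ℝ Fs x) x :=
    (hasDerivAt_inv hne).comp_hasFDerivAt x hd.hasFDerivAt
  have hg1 : ‖fderiv ℝ (fun y => (Fs y)⁻¹) x‖ ≤ ‖fderiv ℝ Fs x‖ := by
    rw [hginv.fderiv, norm_smul, norm_neg, norm_inv, norm_pow, Real.norm_eq_abs, abs_of_pos hpos]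
    exact mul_le_of_le_one_left (norm_nonneg _) (inv_le_one_of_one_le₀ (one_le_pow₀ h1))
  refine ⟨hg0, hg1, ?_⟩
  -- the gradient near `x`: `D F⁻¹ = -(F⁻¹ F⁻¹) DF`
  have hev_d : ∀ᶠ y in 𝓝 x, DifferentiableAt ℝ Fs y :=
    (hFs.eventually h2).mono fun y hy => hy.differentiableAt (by simp)
  have hev_ne : ∀ᶠ y in 𝓝 x, Fs y ≠ 0 := hd.continuousAt.eventually_ne hne
  have hformula : fderiv ℝ (fun y => (Fs y)⁻¹) =ᶠ[𝓝 x]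
      fun y => (-((Fs y)⁻¹ * (Fs y)⁻¹)) • fderiv ℝ Fs y := by
    filter_upwards [hev_d, hev_ne] with y hdy hney
    have hy : HasFDerivAt (fun y => (Fs y)⁻¹) ((-(Fs y ^ 2)⁻¹) • fderiv ℝ Fs y) y :=
      (hasDerivAt_inv hney).comp_hasFDerivAt y hdy.hasFDerivAt
    rw [hy.fderiv, sq, mul_inv]
  rw [hformula.fderiv_eq]
  -- differentiate the product once more at `x`
  have hDFs : DifferentiableAt ℝ (fderiv ℝ Fs) x :=
    (hFs.fderiv_right (m := 1) one_add_one_eq_two.le).differentiableAt one_ne_zero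
  have hg' : HasFDerivAt (fun y => (Fs y)⁻¹) (fderiv ℝ (fun y => (Fs y)⁻¹) x) x :=
    hginv.differentiableAt.hasFDerivAt
  have hc : HasFDerivAt (fun y => -((Fs y)⁻¹ * (Fs y)⁻¹))
      (-((Fs x)⁻¹ • fderiv ℝ (fun y => (Fs y)⁻¹) x +
        (Fs x)⁻¹ • fderiv ℝ (fun y => (Fs y)⁻¹) x)) x :=
    (hg'.mul hg').neg
  have hprod : HasFDerivAt (fun y => (-((Fs y)⁻¹ * (Fs y)⁻¹)) • fderiv ℝ Fs y)
      ((-((Fs x)⁻¹ * (Fs x)⁻¹)) • fderiv ℝ (fderiv ℝ Fs) x +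
        (-((Fs x)⁻¹ • fderiv ℝ (fun y => (Fs y)⁻¹) x +
          (Fs x)⁻¹ • fderiv ℝ (fun y => (Fs y)⁻¹) x)).smulRight (fderiv ℝ Fs x)) x :=
    hc.smul hDFs.hasFDerivAt
  rw [hprod.fderiv]
  -- test against a vector (all the remaining norms live in `E →L[ℝ] ℝ`)
  refine ContinuousLinearMap.opNorm_le_bound _
    (add_nonneg (ContinuousLinearMap.opNorm_nonneg _) (by positivity)) fun v => ?_
  have hv : ((-((Fs x)⁻¹ * (Fs x)⁻¹)) • fderiv ℝ (fderiv ℝ Fs) x +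
        (-((Fs x)⁻¹ • fderiv ℝ (fun y => (Fs y)⁻¹) x +
          (Fs x)⁻¹ • fderiv ℝ (fun y => (Fs y)⁻¹) x)).smulRight (fderiv ℝ Fs x)) v =
      (-((Fs x)⁻¹ * (Fs x)⁻¹)) • fderiv ℝ (fderiv ℝ Fs) x v +
        (-((Fs x)⁻¹ * fderiv ℝ (fun y => (Fs y)⁻¹) x v +
          (Fs x)⁻¹ * fderiv ℝ (fun y => (Fs y)⁻¹) x v)) • fderiv ℝ Fs x := rfl
  rw [hv]
  set g₀ : ℝ := (Fs x)⁻¹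
  set Dg := fderiv ℝ (fun y => (Fs y)⁻¹) x
  set DF := fderiv ℝ Fs x
  set D2F := fderiv ℝ (fderiv ℝ Fs) x
  -- scalar bookkeeping
  have hgv : |Dg v| ≤ ‖DF‖ * ‖v‖ :=
    (Real.norm_eq_abs _).symm.le.trans
      ((Dg.le_opNorm v).trans (mul_le_mul_of_nonneg_right hg1 (norm_nonneg v)))
  have hgDg : |g₀ * Dg v| ≤ ‖DF‖ * ‖v‖ := by
    rw [abs_mul]
    calc |g₀| * |Dg v| ≤ 1 * (‖DF‖ * ‖v‖) := by gcongr
      _ = ‖DF‖ * ‖v‖ := one_mul _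
  have T1 : ‖(-(g₀ * g₀)) • D2F v‖ ≤ ‖D2F‖ * ‖v‖ := by
    rw [norm_smul, norm_neg, norm_mul, Real.norm_eq_abs]
    calc |g₀| * |g₀| * ‖D2F v‖ ≤ 1 * 1 * ‖D2F v‖ := by gcongr
      _ = ‖D2F v‖ := by ring
      _ ≤ ‖D2F‖ * ‖v‖ := D2F.le_opNorm v
  have T2 : ‖(-(g₀ * Dg v + g₀ * Dg v)) • DF‖ ≤ 2 * ‖DF‖ ^ 2 * ‖v‖ := by
    rw [norm_smul, norm_neg, Real.norm_eq_abs]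
    calc |g₀ * Dg v + g₀ * Dg v| * ‖DF‖ ≤ (‖DF‖ * ‖v‖ + ‖DF‖ * ‖v‖) * ‖DF‖ :=
          mul_le_mul_of_nonneg_right ((abs_add_le _ _).trans (add_le_add hgDg hgDg))
            (norm_nonneg _)
      _ = 2 * ‖DF‖ ^ 2 * ‖v‖ := by ring
  calc ‖(-(g₀ * g₀)) • D2F v + (-(g₀ * Dg v + g₀ * Dg v)) • DF‖
      ≤ ‖(-(g₀ * g₀)) • D2F v‖ + ‖(-(g₀ * Dg v + g₀ * Dg v)) • DF‖ := norm_add_le _ _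
    _ ≤ ‖D2F‖ * ‖v‖ + 2 * ‖DF‖ ^ 2 * ‖v‖ := add_le_add T1 T2
    _ = (‖D2F‖ + 2 * ‖DF‖ ^ 2) * ‖v‖ := by ring

/-- **Quotient-rule bookkeeping at a point.**  If `G = F` near `x`, `F x ≥ 1`, and `f`, `F` are
`C²` at `x`, then `‖D(f/G)(x)‖ ≤ ‖Df‖ + |f| ‖DF‖` and
`‖D²(f/G)(x)‖ ≤ ‖D²f‖ + 2 ‖Df‖ ‖DF‖ + |f| (‖D²F‖ + 2 ‖DF‖²)` (Leibniz rule for `f · F⁻¹` and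
`inv_bounds`). [folklore] -/
theorem div_bounds {f Fs G : E → ℝ} {x : E} (hf : ContDiffAt ℝ 2 f x) (hFs : ContDiffAt ℝ 2 Fs x)
    (hG : G =ᶠ[𝓝 x] Fs) (h1 : 1 ≤ Fs x) :
    ‖fderiv ℝ (fun y => f y / G y) x‖ ≤ ‖fderiv ℝ f x‖ + |f x| * ‖fderiv ℝ Fs x‖ ∧
    ‖iteratedFDeriv ℝ 2 (fun y => f y / G y) x‖ ≤
      ‖iteratedFDeriv ℝ 2 f x‖ + 2 * ‖fderiv ℝ f x‖ * ‖fderiv ℝ Fs x‖ +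
        |f x| * (‖iteratedFDeriv ℝ 2 Fs x‖ + 2 * ‖fderiv ℝ Fs x‖ ^ 2) := by
  obtain ⟨hg0, hg1, hg2⟩ := inv_bounds hFs h1
  have hne : Fs x ≠ 0 := (one_pos.trans_le h1).ne'
  have h2 : (2 : WithTop ℕ∞) ≠ ∞ := by simp
  have hginv : ContDiffAt ℝ 2 (fun y => (Fs y)⁻¹) x := hFs.fun_inv hne
  have hEq : (fun y => f y / G y) =ᶠ[𝓝 x] fun y => f y * (Fs y)⁻¹ :=
    hG.mono fun y hy => by simp only [hy, div_eq_mul_inv]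
  have hfd : DifferentiableAt ℝ f x := hf.differentiableAt (by simp)
  have hgd : DifferentiableAt ℝ (fun y => (Fs y)⁻¹) x := hginv.differentiableAt (by simp)
  refine ⟨?_, ?_⟩
  · rw [hEq.fderiv_eq, fderiv_fun_mul hfd hgd]
    calc ‖f x • fderiv ℝ (fun y => (Fs y)⁻¹) x + (Fs x)⁻¹ • fderiv ℝ f x‖
        ≤ ‖f x • fderiv ℝ (fun y => (Fs y)⁻¹) x‖ + ‖(Fs x)⁻¹ • fderiv ℝ f x‖ := norm_add_le _ _
      _ = |f x| * ‖fderiv ℝ (fun y => (Fs y)⁻¹) x‖ + |(Fs x)⁻¹| * ‖fderiv ℝ f x‖ := by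
          rw [norm_smul, norm_smul, Real.norm_eq_abs, Real.norm_eq_abs]
      _ ≤ |f x| * ‖fderiv ℝ Fs x‖ + 1 * ‖fderiv ℝ f x‖ := by gcongr
      _ = ‖fderiv ℝ f x‖ + |f x| * ‖fderiv ℝ Fs x‖ := by ring
  · rw [(hEq.iteratedFDeriv (𝕜 := ℝ) 2).eq_of_nhds, norm_iteratedFDeriv_two,
      norm_iteratedFDeriv_two, norm_iteratedFDeriv_two]
    -- the gradient of the product near `x`
    have hev_f : ∀ᶠ y in 𝓝 x, DifferentiableAt ℝ f y :=
      (hf.eventually h2).mono fun y hy => hy.differentiableAt (by simp)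
    have hev_g : ∀ᶠ y in 𝓝 x, DifferentiableAt ℝ (fun y => (Fs y)⁻¹) y :=
      (hginv.eventually h2).mono fun y hy => hy.differentiableAt (by simp)
    have hD1 : fderiv ℝ (fun y => f y * (Fs y)⁻¹) =ᶠ[𝓝 x]
        fun y => f y • fderiv ℝ (fun y => (Fs y)⁻¹) y + (Fs y)⁻¹ • fderiv ℝ f y := by
      filter_upwards [hev_f, hev_g] with y hfy hgy
      exact fderiv_fun_mul hfy hgy
    rw [hD1.fderiv_eq]
    -- and its derivative at `x`
    have hDf : DifferentiableAt ℝ (fderiv ℝ f) x :=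
      (hf.fderiv_right (m := 1) one_add_one_eq_two.le).differentiableAt one_ne_zero
    have hDg : DifferentiableAt ℝ (fderiv ℝ fun y => (Fs y)⁻¹) x :=
      (hginv.fderiv_right (m := 1) one_add_one_eq_two.le).differentiableAt one_ne_zero
    have hsum : HasFDerivAt
        (fun y => f y • fderiv ℝ (fun y => (Fs y)⁻¹) y + (Fs y)⁻¹ • fderiv ℝ f y)
        (f x • fderiv ℝ (fderiv ℝ fun y => (Fs y)⁻¹) x +
            (fderiv ℝ f x).smulRight (fderiv ℝ (fun y => (Fs y)⁻¹) x) +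
          ((Fs x)⁻¹ • fderiv ℝ (fderiv ℝ f) x +
            (fderiv ℝ (fun y => (Fs y)⁻¹) x).smulRight (fderiv ℝ f x))) x :=
      (hfd.hasFDerivAt.smul hDg.hasFDerivAt).add (hgd.hasFDerivAt.smul hDf.hasFDerivAt)
    rw [hsum.fderiv]
    -- test against a vector (all the remaining norms live in `E →L[ℝ] ℝ`)
    refine ContinuousLinearMap.opNorm_le_bound _
      (add_nonneg (add_nonneg (ContinuousLinearMap.opNorm_nonneg _) (by positivity))
        (mul_nonneg (abs_nonneg _)
          (add_nonneg (ContinuousLinearMap.opNorm_nonneg _) (by positivity)))) fun v => ?_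
    have hv : (f x • fderiv ℝ (fderiv ℝ fun y => (Fs y)⁻¹) x +
            (fderiv ℝ f x).smulRight (fderiv ℝ (fun y => (Fs y)⁻¹) x) +
          ((Fs x)⁻¹ • fderiv ℝ (fderiv ℝ f) x +
            (fderiv ℝ (fun y => (Fs y)⁻¹) x).smulRight (fderiv ℝ f x))) v =
        f x • fderiv ℝ (fderiv ℝ fun y => (Fs y)⁻¹) x v +
            fderiv ℝ f x v • fderiv ℝ (fun y => (Fs y)⁻¹) x +
          ((Fs x)⁻¹ • fderiv ℝ (fderiv ℝ f) x v +
            fderiv ℝ (fun y => (Fs y)⁻¹) x v • fderiv ℝ f x) := rfl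
    rw [hv]
    set D2g := fderiv ℝ (fderiv ℝ fun y => (Fs y)⁻¹) x
    set Dg := fderiv ℝ (fun y => (Fs y)⁻¹) x
    set Df := fderiv ℝ f x
    set D2f := fderiv ℝ (fderiv ℝ f) x
    set DF := fderiv ℝ Fs x
    set D2F := fderiv ℝ (fderiv ℝ Fs) x
    -- scalar bookkeeping
    have hDfv : |Df v| ≤ ‖Df‖ * ‖v‖ := (Real.norm_eq_abs _).symm.le.trans (Df.le_opNorm v)
    have hDgv : |Dg v| ≤ ‖DF‖ * ‖v‖ :=
      (Real.norm_eq_abs _).symm.le.trans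
        ((Dg.le_opNorm v).trans (mul_le_mul_of_nonneg_right hg1 (norm_nonneg v)))
    have T1 : ‖f x • D2g v‖ ≤ |f x| * ((‖D2F‖ + 2 * ‖DF‖ ^ 2) * ‖v‖) := by
      rw [norm_smul, Real.norm_eq_abs]
      exact mul_le_mul_of_nonneg_left
        ((D2g.le_opNorm v).trans (mul_le_mul_of_nonneg_right hg2 (norm_nonneg v))) (abs_nonneg _)
    have T2 : ‖Df v • Dg‖ ≤ ‖Df‖ * ‖v‖ * ‖DF‖ := by
      rw [norm_smul, Real.norm_eq_abs]
      exact mul_le_mul hDfv hg1 (norm_nonneg _) (by positivity)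
    have T3 : ‖(Fs x)⁻¹ • D2f v‖ ≤ ‖D2f‖ * ‖v‖ := by
      rw [norm_smul, Real.norm_eq_abs]
      calc |(Fs x)⁻¹| * ‖D2f v‖ ≤ 1 * ‖D2f v‖ := mul_le_mul_of_nonneg_right hg0 (norm_nonneg _)
        _ = ‖D2f v‖ := one_mul _
        _ ≤ ‖D2f‖ * ‖v‖ := D2f.le_opNorm v
    have T4 : ‖Dg v • Df‖ ≤ ‖DF‖ * ‖v‖ * ‖Df‖ := by
      rw [norm_smul, Real.norm_eq_abs]
      exact mul_le_mul_of_nonneg_right hDgv (norm_nonneg _)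
    calc ‖f x • D2g v + Df v • Dg + ((Fs x)⁻¹ • D2f v + Dg v • Df)‖
        ≤ ‖f x • D2g v + Df v • Dg‖ + ‖(Fs x)⁻¹ • D2f v + Dg v • Df‖ := norm_add_le _ _
      _ ≤ ‖f x • D2g v‖ + ‖Df v • Dg‖ + (‖(Fs x)⁻¹ • D2f v‖ + ‖Dg v • Df‖) :=
          add_le_add (norm_add_le _ _) (norm_add_le _ _)
      _ ≤ |f x| * ((‖D2F‖ + 2 * ‖DF‖ ^ 2) * ‖v‖) + ‖Df‖ * ‖v‖ * ‖DF‖ +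
            (‖D2f‖ * ‖v‖ + ‖DF‖ * ‖v‖ * ‖Df‖) := add_le_add (add_le_add T1 T2) (add_le_add T3 T4)
      _ = (‖D2f‖ + 2 * ‖Df‖ * ‖DF‖ + |f x| * (‖D2F‖ + 2 * ‖DF‖ ^ 2)) * ‖v‖ := by ring

/-- **Local finite-sum form of a locally finite sum.**  If on `U ∈ 𝓝 x` only the `φ γ` with `γ`
in a finite set `T` can be non-zero, and every `φ γ` with `γ ∉ s` vanishes identically near `x`,
then `∑ᶠ_γ φ γ = ∑_{γ ∈ s} φ γ` near `x`. [folklore] -/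
theorem finsum_eventuallyEq_sum {Γ V : Type*} [TopologicalSpace V] {φ : Γ → V → ℝ} {x : V} {U : Set V}
    (hU : U ∈ 𝓝 x)
    {T : Set Γ} (hT : T.Finite) (hTU : ∀ y ∈ U, ∀ γ : Γ, φ γ y ≠ 0 → γ ∈ T) (s : Finset Γ)
    (hs : ∀ γ : Γ, γ ∉ s → φ γ =ᶠ[𝓝 x] fun _ => 0) :
    (fun y => ∑ᶠ γ : Γ, φ γ y) =ᶠ[𝓝 x] fun y => ∑ γ ∈ s, φ γ y := by
  have hev : ∀ᶠ y in 𝓝 x, ∀ γ ∈ hT.toFinset, γ ∉ s → φ γ y = 0 := by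
    refine (Filter.eventually_all_finset _).2 fun γ _ => ?_
    by_cases hγ : γ ∈ s
    · exact Filter.Eventually.of_forall fun y h => (h hγ).elim
    · exact (hs γ hγ).mono fun y hy _ => hy
  filter_upwards [hU, hev] with y hyU hy
  refine finsum_eq_sum_of_support_subset _ fun γ hγ => ?_
  have hne : φ γ y ≠ 0 := Function.mem_support.1 hγ
  by_contra hγs
  exact hne (hy γ (hT.mem_toFinset.2 (hTU y hyU γ hne)) fun h => hγs (Finset.mem_coe.2 h))

end POUNormalise

/-- **Stub POU-B — normalising a cut-off into a `Γ`-partition of unity, with the derivative bookkeeping.**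
If `χ ≥ 0` is smooth on the `Γ`-stable open `X`, its translates `χ ∘ a γ⁻¹` form a locally finite family
on `X`, and every point of `X` has a translate where `χ = 1`, then `F = ∑ᶠ_γ χ ∘ a γ⁻¹ ≥ 1` is smooth and
`Γ`-invariant on `X` and `ψ = χ / F` is a `Γ`-partition of unity (`TwistedQuotient.IsPOU`), with
`ψ ∘ a γ⁻¹ = (χ ∘ a γ⁻¹) / F` and the quotient-rule bounds for the first two derivatives of the translates
in terms of those of the translates of `χ` over any finite set carrying the family near the point.
[cite: BottTu1982Forms, §II.8] [folklore] -/
theorem stub_isPOU_of_cover {Γ : Type} [Group Γ]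
    {W : Type} [NormedAddCommGroup W] [NormedSpace ℝ W] [FiniteDimensional ℝ W]
    (a : Γ →* (W →L[ℝ] W)) {X : Set W} (hXo : IsOpen X) (hmaps : ∀ γ : Γ, Set.MapsTo (a γ) X X)
    (χ : W → ℝ) (hχs : ContDiffOn ℝ ((⊤ : ℕ∞) : WithTop ℕ∞) χ X) (hχ0 : ∀ x ∈ X, 0 ≤ χ x)
    (hfin : ∀ x ∈ X, ∃ U ∈ 𝓝 x, {γ : Γ | ∃ y ∈ U, χ (a γ⁻¹ y) ≠ 0}.Finite)
    (hcov : ∀ x ∈ X, ∃ γ : Γ, χ (a γ⁻¹ x) = 1) :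
    TwistedQuotient.IsPOU a X (fun x => χ x / ∑ᶠ γ : Γ, χ (a γ⁻¹ x)) ∧
    (∀ x ∈ X, 1 ≤ ∑ᶠ γ : Γ, χ (a γ⁻¹ x)) ∧
    (∀ x ∈ X, ∀ δ : Γ, ∑ᶠ γ : Γ, χ (a γ⁻¹ (a δ x)) = ∑ᶠ γ : Γ, χ (a γ⁻¹ x)) ∧
    (∀ x ∈ X, ∀ δ : Γ, 0 ≤ χ (a δ⁻¹ x) / ∑ᶠ γ : Γ, χ (a γ⁻¹ (a δ⁻¹ x)) ∧
      χ (a δ⁻¹ x) / ∑ᶠ γ : Γ, χ (a γ⁻¹ (a δ⁻¹ x)) ≤ 1) ∧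
    ∀ x ∈ X, ∀ s : Finset Γ, (∀ γ : Γ, γ ∉ s → (fun y => χ (a γ⁻¹ y)) =ᶠ[𝓝 x] fun _ => 0) →
      ∀ δ : Γ,
        ‖fderiv ℝ (fun y => χ (a δ⁻¹ y) / ∑ᶠ γ : Γ, χ (a γ⁻¹ (a δ⁻¹ y))) x‖ ≤
            ‖fderiv ℝ (fun y => χ (a δ⁻¹ y)) x‖ +
              |χ (a δ⁻¹ x)| * ∑ γ ∈ s, ‖fderiv ℝ (fun y => χ (a γ⁻¹ y)) x‖ ∧
        ‖iteratedFDeriv ℝ 2 (fun y => χ (a δ⁻¹ y) / ∑ᶠ γ : Γ, χ (a γ⁻¹ (a δ⁻¹ y))) x‖ ≤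
            ‖iteratedFDeriv ℝ 2 (fun y => χ (a δ⁻¹ y)) x‖ +
              2 * ‖fderiv ℝ (fun y => χ (a δ⁻¹ y)) x‖ * ∑ γ ∈ s, ‖fderiv ℝ (fun y => χ (a γ⁻¹ y)) x‖ +
              |χ (a δ⁻¹ x)| * (∑ γ ∈ s, ‖iteratedFDeriv ℝ 2 (fun y => χ (a γ⁻¹ y)) x‖ +
                2 * (∑ γ ∈ s, ‖fderiv ℝ (fun y => χ (a γ⁻¹ y)) x‖) ^ 2) := by
  -- translates of points of `X` stay in `X`, so all translates of `χ` are `≥ 0` on `X`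
  have hmem : ∀ (γ : Γ) {x : W}, x ∈ X → a γ⁻¹ x ∈ X := fun γ _ hx => hmaps γ⁻¹ hx
  have hnn : ∀ x ∈ X, ∀ γ : Γ, 0 ≤ χ (a γ⁻¹ x) := fun x hx γ => hχ0 _ (hmem γ hx)
  -- at a point of `X` only finitely many translates are non-zero
  have hsupp : ∀ x ∈ X, (Function.support fun γ : Γ => χ (a γ⁻¹ x)).Finite := by
    intro x hx
    obtain ⟨U, hU, hF⟩ := hfin x hx
    exact hF.subset fun γ hγ => ⟨x, mem_of_mem_nhds hU, hγ⟩
  -- `1 ≤ F` on `X`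
  have hF1 : ∀ x ∈ X, 1 ≤ ∑ᶠ γ : Γ, χ (a γ⁻¹ x) := by
    intro x hx
    obtain ⟨γ₀, hγ₀⟩ := hcov x hx
    calc (1 : ℝ) = χ (a γ₀⁻¹ x) := hγ₀.symm
      _ ≤ ∑ᶠ γ : Γ, χ (a γ⁻¹ x) :=
        single_le_finsum (f := fun γ : Γ => χ (a γ⁻¹ x)) γ₀ (hsupp x hx) (hnn x hx)
  have hFpos : ∀ x ∈ X, 0 < ∑ᶠ γ : Γ, χ (a γ⁻¹ x) := fun x hx => one_pos.trans_le (hF1 x hx)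
  -- `Γ`-invariance of `F` (reindex `γ ↦ δ⁻¹ γ`); this holds at every point of `W`
  have hinv : ∀ (x : W) (δ : Γ), ∑ᶠ γ : Γ, χ (a γ⁻¹ (a δ x)) = ∑ᶠ γ : Γ, χ (a γ⁻¹ x) := by
    intro x δ
    refine finsum_eq_of_bijective (fun γ => δ⁻¹ * γ) (Group.mulLeft_bijective δ⁻¹) fun γ => ?_
    simp only [mul_inv_rev, inv_inv, map_mul, mul_apply_eq_comp]
  -- the translates of `χ` are smooth at the points of `X`
  have hsm : ∀ (γ : Γ) {x : W}, x ∈ X → ContDiffAt ℝ ∞ (fun y => χ (a γ⁻¹ y)) x :=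
    fun γ x hx => (hχs.contDiffAt (hXo.mem_nhds (hmem γ hx))).comp x (a γ⁻¹).contDiff.contDiffAt
  -- local finite-sum form of `F` near a point of `X`
  have hloc : ∀ x ∈ X, ∀ s : Finset Γ,
      (∀ γ : Γ, γ ∉ s → (fun y => χ (a γ⁻¹ y)) =ᶠ[𝓝 x] fun _ => 0) →
      (fun y => ∑ᶠ γ : Γ, χ (a γ⁻¹ y)) =ᶠ[𝓝 x] fun y => ∑ γ ∈ s, χ (a γ⁻¹ y) := by
    intro x hx s hs
    obtain ⟨U, hU, hT⟩ := hfin x hx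
    exact POUNormalise.finsum_eventuallyEq_sum (φ := fun (γ : Γ) (y : W) => χ (a γ⁻¹ y)) hU hT
      (fun y hy γ h => ⟨y, hy, h⟩) s hs
  -- every point of `X` has some finite set carrying the family near it
  have hcarry : ∀ x ∈ X, ∃ s : Finset Γ,
      ∀ γ : Γ, γ ∉ s → (fun y => χ (a γ⁻¹ y)) =ᶠ[𝓝 x] fun _ => 0 := by
    intro x hx
    obtain ⟨U, hU, hT⟩ := hfin x hx
    refine ⟨hT.toFinset, fun γ hγ => ?_⟩
    filter_upwards [hU] with y hy
    by_contra h
    exact hγ (hT.mem_toFinset.2 ⟨y, hy, h⟩)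
  -- hence `F` is smooth on `X`
  have hFsmooth : ContDiffOn ℝ ∞ (fun y => ∑ᶠ γ : Γ, χ (a γ⁻¹ y)) X := by
    intro x hx
    obtain ⟨s, hs⟩ := hcarry x hx
    exact ((ContDiffAt.sum fun γ _ => hsm γ hx).congr_of_eventuallyEq
      (hloc x hx s hs)).contDiffWithinAt
  refine ⟨⟨?_, ?_, ?_⟩, hF1, fun x _ δ => hinv x δ, ?_, ?_⟩
  · -- `ψ = χ / F` is smooth on `X`
    exact hχs.fun_div hFsmooth fun x hx => (hFpos x hx).ne'
  · -- the translates of `ψ` form a locally finite family on `X`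
    intro x hx
    obtain ⟨U, hU, hT⟩ := hfin x hx
    refine ⟨U, hU, hT.subset ?_⟩
    rintro γ ⟨y, hy, hne⟩
    refine ⟨y, hy, fun h => hne ?_⟩
    simp only [h, zero_div]
  · -- `∑_γ ψ ∘ a γ⁻¹ = 1` on `X` (by the invariance of `F`)
    intro x hx
    calc ∑ᶠ γ : Γ, χ (a γ⁻¹ x) / ∑ᶠ γ' : Γ, χ (a γ'⁻¹ (a γ⁻¹ x))
        = ∑ᶠ γ : Γ, χ (a γ⁻¹ x) * (∑ᶠ γ' : Γ, χ (a γ'⁻¹ x))⁻¹ :=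
          finsum_congr fun γ => by rw [hinv, div_eq_mul_inv]
      _ = (∑ᶠ γ : Γ, χ (a γ⁻¹ x)) * (∑ᶠ γ' : Γ, χ (a γ'⁻¹ x))⁻¹ := (finsum_mul _ _).symm
      _ = 1 := mul_inv_cancel₀ (hFpos x hx).ne'
  · -- `0 ≤ ψ ∘ a δ⁻¹ ≤ 1` on `X`
    intro x hx δ
    have hz : a δ⁻¹ x ∈ X := hmem δ hx
    refine ⟨div_nonneg (hχ0 _ hz) (hFpos _ hz).le, div_le_one_of_le₀ ?_ (hFpos _ hz).le⟩
    have h1 := single_le_finsum (f := fun γ : Γ => χ (a γ⁻¹ (a δ⁻¹ x))) 1 (hsupp _ hz) (hnn _ hz)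
    simpa only [inv_one, map_one, one_apply_eq_self] using h1
  · -- the quotient-rule bounds
    intro x hx s hs δ
    -- `ψ ∘ a δ⁻¹ = χ_δ / F` on `X` and `F = ∑_{γ ∈ s} χ_γ` near `x`
    have hG : (fun y => ∑ᶠ γ : Γ, χ (a γ⁻¹ (a δ⁻¹ y))) =ᶠ[𝓝 x]
        fun y => ∑ γ ∈ s, χ (a γ⁻¹ y) := by
      filter_upwards [hloc x hx s hs] with y hy
      rw [hinv, hy]
    have h2 : ∀ γ : Γ, ContDiffAt ℝ 2 (fun y => χ (a γ⁻¹ y)) x := fun γ =>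
      (hsm γ hx).of_le (WithTop.coe_le_coe.2 le_top)
    have hFs2 : ContDiffAt ℝ 2 (fun y => ∑ γ ∈ s, χ (a γ⁻¹ y)) x :=
      ContDiffAt.sum fun γ _ => h2 γ
    have h1s : 1 ≤ ∑ γ ∈ s, χ (a γ⁻¹ x) := by
      rw [← (hloc x hx s hs).eq_of_nhds]
      exact hF1 x hx
    obtain ⟨hb1, hb2⟩ := POUNormalise.div_bounds (h2 δ) hFs2 hG h1s
    -- `‖DF‖ ≤ ∑_s ‖Dχ_γ‖` and `‖D²F‖ ≤ ∑_s ‖D²χ_γ‖` at `x`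
    have hD1 : ‖fderiv ℝ (fun y => ∑ γ ∈ s, χ (a γ⁻¹ y)) x‖ ≤
        ∑ γ ∈ s, ‖fderiv ℝ (fun y => χ (a γ⁻¹ y)) x‖ := by
      rw [fderiv_fun_sum fun γ _ => (h2 γ).differentiableAt (by simp)]
      exact norm_sum_le _ _
    have hD2 : ‖iteratedFDeriv ℝ 2 (fun y => ∑ γ ∈ s, χ (a γ⁻¹ y)) x‖ ≤
        ∑ γ ∈ s, ‖iteratedFDeriv ℝ 2 (fun y => χ (a γ⁻¹ y)) x‖ := by
      rw [iteratedFDeriv_fun_sum_apply fun γ _ => h2 γ]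
      exact norm_sum_le _ _
    refine ⟨hb1.trans ?_, hb2.trans ?_⟩
    · gcongr
    · gcongr

end Summit.Langlands.Langlands.Theorems.HeckeEigenvalueField.Res

end
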